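import Literature.Computability.Complexity.HardcoreInapproximabilitySecondMomentQB
import Literature.Computability.Complexity.HardcoreInapproximabilitySecondMomentRate
import Literature.Computability.Complexity.HardcoreInapproximabilitySecondMomentAcoef
import HarnessLib

/-!
# Windows for the Laplace analysis of the second moment

Cell margins at and near the product point (`slyCells_cstar_ge`, `slyCells_near_ge`,
`slyCellsA_cstar_ge`, `slyCellsA_near_ge`), the integer interior conditions of the Stirling forms
(`slyInterior_of_cells`, `slyInteriorA_of_cells`), polytope membership of non-degenerate inner terms
(`mem_slyPolytope_of_slyT_ne_zero`), the size of `Q_d` on the `(h₁,h₂)`-plane (`abs_slyQ_plane_le`),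
the **far gap** of the colour rate from `-H_d ≻ κ` and the gap of `f_d` (`slyFar_gap`), and the
Lipschitz bound for the overlap prefactor (`abs_slyPrefA_sub_le`).

## References
* [Sly2010] A. Sly, FOCS 2010 / arXiv:1005.5584, §3.2–3.3.
* [MosselWeitzWormald2008] E. Mossel, D. Weitz, N. Wormald, PTRF 143 (2009), proof of Theorem 6.11.
-/

namespace Literature.Computability.Complexity

open Real Finset

section Cells

variable {α β : ℝ}

/-- **At the product point every cell density is at least `m²`**, `m = min(α, β, 1-α-β)` (the pair
table at `c*` is the product of two single tables with entries `α, β, 1-α-β`). [folklore] -/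
theorem slyCells_cstar_ge (hα : 0 < α) (hβ : 0 < β) (hαβ : α + β < 1) {m : ℝ}
    (hm : m = min (min α β) (1 - α - β)) :
    ∀ u ∈ slyCells α β (α ^ 2) (β ^ 2) (α * (1 - α - β)), m ^ 2 ≤ u := by
  have h1 : m ≤ α := by rw [hm]; exact le_trans (min_le_left _ _) (min_le_left _ _)
  have h2 : m ≤ β := by rw [hm]; exact le_trans (min_le_left _ _) (min_le_right _ _)
  have h3 : m ≤ 1 - α - β := by rw [hm]; exact min_le_right _ _
  have hm0 : 0 < m := by rw [hm]; exact lt_min (lt_min hα hβ) (by linarith)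
  have hα1 : m ≤ 1 - α := by linarith
  have hβ1 : m ≤ 1 - β := by linarith
  have hm1 : m ≤ 1 := by linarith
  intro u hu
  simp only [slyCells, List.mem_cons, List.mem_nil_iff, or_false] at hu
  have P : ∀ {x y : ℝ}, m ≤ x → m ≤ y → m ^ 2 ≤ x * y := fun hx hy => by
    rw [sq]; exact mul_le_mul hx hy hm0.le (le_trans hm0.le hx)
  rcases hu with rfl | rfl | rfl | rfl | rfl | rfl | rfl | rfl | rfl | rfl | rfl | rfl | rfl
  · calc m ^ 2 ≤ α * α := P h1 h1
      _ = α ^ 2 := by ring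
  · exact P h1 h3
  · nlinarith [P hβ1 hβ1]
  · nlinarith [P h3 (show m ≤ 1 - β + α by linarith)]
  · nlinarith [P h3 hβ1]
  · nlinarith [P h2 hβ1]
  · nlinarith [P h1 h2]
  · nlinarith [P h2 h3]
  · nlinarith [P hα1 hβ1, hm0]
  · nlinarith [P h1 hα1]
  · nlinarith [P hα1 hβ1]
  · nlinarith [P h1 h1, hm1, hm0]
  · nlinarith [P hα1 hα1]

/-- **Near the product point every cell density is at least `m²/2`**: if `‖c - c*‖₁ ≤ m²/2`.
[folklore] -/
theorem slyCells_near_ge (hα : 0 < α) (hβ : 0 < β) (hαβ : α + β < 1) {m : ℝ}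
    (hm : m = min (min α β) (1 - α - β)) {γ δ ε : ℝ}
    (hnear : |γ - α ^ 2| + |δ - β ^ 2| + |ε - α * (1 - α - β)| ≤ m ^ 2 / 2) :
    ∀ u ∈ slyCells α β γ δ ε, m ^ 2 / 2 ≤ u := by
  have H := slyCells_cstar_ge hα hβ hαβ hm
  have g1 := le_abs_self (γ - α ^ 2); have g2 := neg_abs_le (γ - α ^ 2)
  have g3 := le_abs_self (δ - β ^ 2); have g4 := neg_abs_le (δ - β ^ 2)
  have g5 := le_abs_self (ε - α * (1 - α - β)); have g6 := neg_abs_le (ε - α * (1 - α - β))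
  have c1 := H (α ^ 2) (by simp [slyCells])
  have c2 := H (α * (1 - α - β)) (by simp [slyCells])
  have c3 := H (1 - 2 * β + β ^ 2) (by simp [slyCells])
  have c4 := H (1 - 2 * β + β ^ 2 - α ^ 2) (by simp [slyCells])
  have c5 := H (1 - 2 * β + β ^ 2 - α ^ 2 - α * (1 - α - β)) (by simp [slyCells])
  have c6 := H (β - β ^ 2) (by simp [slyCells])
  have c7 := H (α - α ^ 2 - α * (1 - α - β)) (by simp [slyCells])
  have c8 := H (β - β ^ 2 - (α - α ^ 2 - α * (1 - α - β))) (by simp [slyCells])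
  have c9 := H (1 - β - α ^ 2 - α * (1 - α - β)) (by simp [slyCells])
  have c10 := H (α - α ^ 2) (by simp [slyCells])
  have c11 := H (1 - β - α ^ 2 - α * (1 - α - β) - (α - α ^ 2)) (by simp [slyCells])
  have c12 := H (1 - α ^ 2) (by simp [slyCells])
  have c13 := H (1 - α - (α - α ^ 2)) (by simp [slyCells])
  intro u hu
  simp only [slyCells, List.mem_cons, List.mem_nil_iff, or_false] at hu
  rcases hu with rfl | rfl | rfl | rfl | rfl | rfl | rfl | rfl | rfl | rfl | rfl | rfl | rfl <;>
    linarith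

end Cells

section Integer

variable {N a b g h e μ : ℕ} {m₀ : ℝ}

/-- **Cell margins give the integer interior conditions** of `log_slyB0_mul_slyT_interior`.
[folklore] -/
theorem slyInterior_of_cells (hN : 0 < N) (hhb : h ≤ b) (hbN : b + b - h ≤ N)
    (hμ : (μ : ℝ) ≤ N * m₀)
    (hc : ∀ u ∈ slyCells ((a : ℝ) / N) ((b : ℝ) / N) ((g : ℝ) / N) ((h : ℝ) / N) ((e : ℝ) / N),
      m₀ ≤ u) :
    (μ ≤ g ∧ g + μ ≤ N - (b + b - h)) ∧ (μ ≤ e ∧ e + μ ≤ N - (b + b - h) - g) ∧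
      (μ ≤ a - g - e ∧ a - g - e + μ ≤ b - h) ∧ (μ ≤ a - g ∧ a - g + μ ≤ N - b - g - e) ∧
      (μ ≤ a ∧ a - g + μ ≤ N - a ∧ a + μ ≤ N - b) := by
  have hNR : (0 : ℝ) < N := by exact_mod_cast hN
  have hN0 : (N : ℝ) ≠ 0 := hNR.ne'
  have S : ∀ {u : ℝ}, m₀ ≤ u → (N : ℝ) * m₀ ≤ N * u := fun hu => mul_le_mul_of_nonneg_left hu hNR.le
  have m1 := S (hc ((g : ℝ) / N) (by simp [slyCells]))
  have m2 := S (hc ((e : ℝ) / N) (by simp [slyCells]))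
  have m4 := S (hc (1 - 2 * ((b : ℝ) / N) + (h : ℝ) / N - (g : ℝ) / N) (by simp [slyCells]))
  have m5 := S (hc (1 - 2 * ((b : ℝ) / N) + (h : ℝ) / N - (g : ℝ) / N - (e : ℝ) / N)
    (by simp [slyCells]))
  have m7 := S (hc ((a : ℝ) / N - (g : ℝ) / N - (e : ℝ) / N) (by simp [slyCells]))
  have m8 := S (hc ((b : ℝ) / N - (h : ℝ) / N - ((a : ℝ) / N - (g : ℝ) / N - (e : ℝ) / N))
    (by simp [slyCells]))
  have m10 := S (hc ((a : ℝ) / N - (g : ℝ) / N) (by simp [slyCells]))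
  have m11 := S (hc (1 - (b : ℝ) / N - (g : ℝ) / N - (e : ℝ) / N - ((a : ℝ) / N - (g : ℝ) / N))
    (by simp [slyCells]))
  have m13 := S (hc (1 - (a : ℝ) / N - ((a : ℝ) / N - (g : ℝ) / N)) (by simp [slyCells]))
  rw [show (N : ℝ) * ((g : ℝ) / N) = g by field_simp] at m1
  rw [show (N : ℝ) * ((e : ℝ) / N) = e by field_simp] at m2
  rw [show (N : ℝ) * (1 - 2 * ((b : ℝ) / N) + (h : ℝ) / N - (g : ℝ) / N) = N - 2 * b + h - g by
    field_simp] at m4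
  rw [show (N : ℝ) * (1 - 2 * ((b : ℝ) / N) + (h : ℝ) / N - (g : ℝ) / N - (e : ℝ) / N) =
    N - 2 * b + h - g - e by field_simp] at m5
  rw [show (N : ℝ) * ((a : ℝ) / N - (g : ℝ) / N - (e : ℝ) / N) = a - g - e by field_simp] at m7
  rw [show (N : ℝ) * ((b : ℝ) / N - (h : ℝ) / N - ((a : ℝ) / N - (g : ℝ) / N - (e : ℝ) / N)) =
    b - h - (a - g - e) by field_simp] at m8
  rw [show (N : ℝ) * ((a : ℝ) / N - (g : ℝ) / N) = a - g by field_simp] at m10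
  rw [show (N : ℝ) * (1 - (b : ℝ) / N - (g : ℝ) / N - (e : ℝ) / N - ((a : ℝ) / N - (g : ℝ) / N)) =
    N - b - g - e - (a - g) by field_simp] at m11
  rw [show (N : ℝ) * (1 - (a : ℝ) / N - ((a : ℝ) / N - (g : ℝ) / N)) = N - a - (a - g) by
    field_simp] at m13
  have i1 : μ ≤ g := by exact_mod_cast le_trans hμ m1
  have i2 : μ ≤ e := by exact_mod_cast le_trans hμ m2
  have i4 : μ + g + 2 * b ≤ N + h := by
    have : ((μ + g + 2 * b : ℕ) : ℝ) ≤ ((N + h : ℕ) : ℝ) := by push_cast; linarith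
    exact_mod_cast this
  have i5 : μ + g + e + 2 * b ≤ N + h := by
    have : ((μ + g + e + 2 * b : ℕ) : ℝ) ≤ ((N + h : ℕ) : ℝ) := by push_cast; linarith
    exact_mod_cast this
  have i7 : μ + g + e ≤ a := by
    have : ((μ + g + e : ℕ) : ℝ) ≤ ((a : ℕ) : ℝ) := by push_cast; linarith
    exact_mod_cast this
  have i8 : μ + h + a ≤ b + g + e := by
    have : ((μ + h + a : ℕ) : ℝ) ≤ ((b + g + e : ℕ) : ℝ) := by push_cast; linarith
    exact_mod_cast this
  have i10 : μ + g ≤ a := by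
    have : ((μ + g : ℕ) : ℝ) ≤ ((a : ℕ) : ℝ) := by push_cast; linarith
    exact_mod_cast this
  have i11 : μ + b + e + a ≤ N := by
    have : ((μ + b + e + a : ℕ) : ℝ) ≤ ((N : ℕ) : ℝ) := by push_cast; linarith
    exact_mod_cast this
  have i13 : μ + a + a ≤ N + g := by
    have : ((μ + a + a : ℕ) : ℝ) ≤ ((N + g : ℕ) : ℝ) := by push_cast; linarith
    exact_mod_cast this
  omega

end Integer

section Polytope

variable {N a b g h e : ℕ}

/-- **Non-degenerate inner terms lie in the overlap polytope** of the colour's densities. [folklore] -/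
theorem mem_slyPolytope_of_slyT_ne_zero (hN : 0 < N) (hga : g ≤ a) (hhb : h ≤ b)
    (hbN : b + b - h ≤ N) (hgF : g ≤ N - (b + b - h)) (he : e ≤ a - g)
    (ht : slyT N a b g h e ≠ 0) :
    (((g : ℝ) / N, (h : ℝ) / N, (e : ℝ) / N) : ℝ × ℝ × ℝ) ∈ slyPolytope ((a : ℝ) / N) ((b : ℝ) / N) := by
  have hNR : (0 : ℝ) < N := by exact_mod_cast hN
  -- the three binomials are non-zero
  have h1 : e ≤ N - (b + b - h) - g := by
    by_contra hc; push Not at hc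
    apply ht; unfold slyT
    rw [show ((N - (b + b - h) - g).choose e : ℝ) = 0 by exact_mod_cast Nat.choose_eq_zero_of_lt hc]
    ring
  have h2 : a - g - e ≤ b - h := by
    by_contra hc; push Not at hc
    apply ht; unfold slyT
    rw [show ((b - h).choose (a - g - e) : ℝ) = 0 by exact_mod_cast Nat.choose_eq_zero_of_lt hc]
    ring
  have h3 : a - g ≤ N - b - g - e := by
    by_contra hc; push Not at hc
    apply ht; unfold slyT
    rw [show ((N - b - g - e).choose (a - g) : ℝ) = 0 by exact_mod_cast Nat.choose_eq_zero_of_lt hc]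
    ring
  unfold slyPolytope
  simp only [Set.mem_setOf_eq]
  have D : ∀ {x y : ℕ}, x ≤ y → (x : ℝ) / N ≤ (y : ℝ) / N := fun hxy =>
    div_le_div_of_nonneg_right (by exact_mod_cast hxy) hNR.le
  refine ⟨by positivity, by positivity, by positivity, ?_, ?_, ?_, ?_⟩
  · have : ((g + e : ℕ) : ℝ) / N ≤ (a : ℝ) / N := D (by omega)
    push_cast at this; rw [add_div] at this; linarith
  · have : ((h + (a - g - e) : ℕ) : ℝ) / N ≤ (b : ℝ) / N := D (by omega)
    rw [Nat.cast_add, Nat.cast_sub he, Nat.cast_sub hga, add_div, sub_div, sub_div] at this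
    linarith
  · have : ((b + b - h + g + e : ℕ) : ℝ) / N ≤ (N : ℝ) / N := D (by omega)
    rw [div_self hNR.ne'] at this
    rw [Nat.cast_add, Nat.cast_add, Nat.cast_sub (by omega : h ≤ b + b)] at this
    push_cast at this
    rw [add_div, add_div, sub_div, add_div] at this
    linarith
  · have : ((b + e + a : ℕ) : ℝ) / N ≤ (N : ℝ) / N := D (by omega)
    rw [div_self hNR.ne'] at this
    push_cast at this
    rw [add_div, add_div] at this
    linarith

end Polytope

section QuadBound

variable {α β : ℝ}

set_option maxHeartbeats 1600000 in
/-- **Size of `Q_d` on the `(h₁,h₂)`-plane**: `|Q_d(h₁,h₂,0)| ≤ (3(d+2)/m⁵)(|h₁|+|h₂|)²` with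
`m = min(α, β, 1-α-β)`. [folklore] -/
theorem abs_slyQ_plane_le (d : ℕ) (hα : 0 < α) (hβ : 0 < β) (hαβ : α + β < 1) {m : ℝ}
    (hm : m = min (min α β) (1 - α - β)) (h₁ h₂ : ℝ) :
    |slyQ d α β h₁ h₂ 0| ≤ 3 * ((d : ℝ) + 2) / m ^ 5 * (|h₁| + |h₂|) ^ 2 := by
  have h1 : m ≤ α := by rw [hm]; exact le_trans (min_le_left _ _) (min_le_left _ _)
  have h2 : m ≤ β := by rw [hm]; exact le_trans (min_le_left _ _) (min_le_right _ _)
  have h3 : m ≤ 1 - α - β := by rw [hm]; exact min_le_right _ _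
  have hm0 : 0 < m := by rw [hm]; exact lt_min (lt_min hα hβ) (by linarith)
  have hα1 : m ≤ 1 - α := by linarith
  have hβ1 : m ≤ 1 - β := by linarith
  have hm1 : m ≤ 1 := by linarith
  have hd : (0 : ℝ) ≤ d := Nat.cast_nonneg d
  -- bounds on the three planar coefficients
  have hαpos : 0 < 1 - α := by linarith
  have hβpos : 0 < 1 - β := by linarith
  have habpos : 0 < 1 - α - β := by linarith
  -- `|c₁₁| ≤ 4(d+2)/m³`, `|c₂₂| ≤ (d+1)/m⁵`, `|c₁₂| ≤ d/m³`
  have R : ∀ {x : ℝ}, m ≤ x → x ≤ 1 → 1 / x ≤ 1 / m := fun hx _ =>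
    one_div_le_one_div_of_le hm0 hx
  have im3 : ∀ {x y z : ℝ}, m ≤ x → m ≤ y → m ≤ z → x ≤ 1 → y ≤ 1 → z ≤ 1 →
      1 / (x * y * z) ≤ 1 / m ^ 3 := by
    intro x y z hx hy hz _ _ _
    have : m ^ 3 ≤ x * y * z := by
      calc m ^ 3 = m * m * m := by ring
        _ ≤ x * y * z := by
          apply mul_le_mul (mul_le_mul hx hy hm0.le (by linarith)) hz hm0.le
          exact mul_nonneg (by linarith) (by linarith)
    exact one_div_le_one_div_of_le (by positivity) this
  have im5 : 1 / (β ^ 2 * (1 - β) ^ 2 * (1 - α - β)) ≤ 1 / m ^ 5 := by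
    have : m ^ 5 ≤ β ^ 2 * (1 - β) ^ 2 * (1 - α - β) := by
      calc m ^ 5 = (m * m) * (m * m) * m := by ring
        _ ≤ (β * β) * ((1 - β) * (1 - β)) * (1 - α - β) := by
          apply mul_le_mul _ h3 hm0.le (by positivity)
          apply mul_le_mul (mul_le_mul h2 h2 hm0.le (by linarith))
            (mul_le_mul hβ1 hβ1 hm0.le (by linarith)) (by positivity) (by positivity)
        _ = β ^ 2 * (1 - β) ^ 2 * (1 - α - β) := by ring
    exact one_div_le_one_div_of_le (by positivity) this
  have t1 : |((α : ℝ) + d - 2) / (α * (α - 1) ^ 2)| ≤ ((d : ℝ) + 2) / m ^ 3 := by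
    rw [abs_div, show α * (α - 1) ^ 2 = α * (1 - α) * (1 - α) by ring,
      abs_of_pos (show (0 : ℝ) < α * (1 - α) * (1 - α) by positivity)]
    have hnum : |(α : ℝ) + d - 2| ≤ d + 2 := by
      rw [abs_le]; constructor <;> linarith
    calc |(α : ℝ) + d - 2| / (α * (1 - α) * (1 - α))
        ≤ ((d : ℝ) + 2) / (α * (1 - α) * (1 - α)) :=
          div_le_div_of_nonneg_right hnum (by positivity)
      _ = ((d : ℝ) + 2) * (1 / (α * (1 - α) * (1 - α))) := by ring
      _ ≤ ((d : ℝ) + 2) * (1 / m ^ 3) :=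
          mul_le_mul_of_nonneg_left (im3 h1 hα1 hα1 (by linarith) (by linarith) (by linarith))
            (by positivity)
      _ = ((d : ℝ) + 2) / m ^ 3 := by ring
  have t2 : |((β : ℝ) + d * α) / (α ^ 2 * β)| ≤ ((d : ℝ) + 1) / m ^ 3 := by
    rw [abs_div, abs_of_pos (show (0:ℝ) < α ^ 2 * β by positivity),
      abs_of_pos (show (0 : ℝ) < (β : ℝ) + d * α by positivity)]
    have hnum : (β : ℝ) + d * α ≤ d + 1 := by nlinarith
    calc ((β : ℝ) + d * α) / (α ^ 2 * β) ≤ ((d : ℝ) + 1) / (α ^ 2 * β) :=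
          div_le_div_of_nonneg_right hnum (by positivity)
      _ = ((d : ℝ) + 1) * (1 / (α * α * β)) := by ring
      _ ≤ ((d : ℝ) + 1) * (1 / m ^ 3) :=
          mul_le_mul_of_nonneg_left (im3 h1 h1 h2 (by linarith) (by linarith) (by linarith))
            (by positivity)
      _ = ((d : ℝ) + 1) / m ^ 3 := by ring
  have t3 : |(d : ℝ) / ((1 - α) * (1 - β))| ≤ (d : ℝ) / m ^ 3 := by
    rw [abs_of_nonneg (by positivity)]
    calc (d : ℝ) / ((1 - α) * (1 - β)) = d * (1 / ((1 - α) * (1 - β) * 1)) := by ring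
      _ ≤ d * (1 / m ^ 3) :=
          mul_le_mul_of_nonneg_left (im3 hα1 hβ1 hm1 (by linarith) (by linarith) le_rfl) hd
      _ = (d : ℝ) / m ^ 3 := by ring
  have t4 : |(d : ℝ) / (β * (1 - β) * (1 - α - β))| ≤ (d : ℝ) / m ^ 3 := by
    rw [abs_of_nonneg (by positivity)]
    calc (d : ℝ) / (β * (1 - β) * (1 - α - β)) = d * (1 / (β * (1 - β) * (1 - α - β))) := by ring
      _ ≤ d * (1 / m ^ 3) :=
          mul_le_mul_of_nonneg_left (im3 h2 hβ1 h3 (by linarith) (by linarith) (by linarith)) hd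
      _ = (d : ℝ) / m ^ 3 := by ring
  have t5 : |-(1 - α - β + (d : ℝ) * α * β) / (β ^ 2 * (1 - β) ^ 2 * (1 - α - β))| ≤
      ((d : ℝ) + 1) / m ^ 5 := by
    have hnum0 : (0 : ℝ) < 1 - α - β + d * α * β := by
      have := mul_nonneg hd (mul_nonneg hα.le hβ.le); nlinarith
    rw [abs_div, abs_neg, abs_of_pos hnum0,
      abs_of_pos (show (0:ℝ) < β ^ 2 * (1 - β) ^ 2 * (1 - α - β) by positivity)]
    have hnum : 1 - α - β + (d : ℝ) * α * β ≤ d + 1 := by nlinarith [mul_nonneg hd hα.le]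
    calc (1 - α - β + (d : ℝ) * α * β) / (β ^ 2 * (1 - β) ^ 2 * (1 - α - β))
        ≤ ((d : ℝ) + 1) / (β ^ 2 * (1 - β) ^ 2 * (1 - α - β)) :=
          div_le_div_of_nonneg_right hnum (by positivity)
      _ = ((d : ℝ) + 1) * (1 / (β ^ 2 * (1 - β) ^ 2 * (1 - α - β))) := by ring
      _ ≤ ((d : ℝ) + 1) * (1 / m ^ 5) := mul_le_mul_of_nonneg_left im5 (by positivity)
      _ = ((d : ℝ) + 1) / m ^ 5 := by ring
  -- `1/m³ ≤ 1/m⁵`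
  have hm35 : 1 / m ^ 3 ≤ 1 / m ^ 5 := by
    apply one_div_le_one_div_of_le (by positivity)
    calc m ^ 5 = m ^ 3 * (m * m) := by ring
      _ ≤ m ^ 3 * 1 := by
          apply mul_le_mul_of_nonneg_left _ (by positivity); nlinarith
      _ = m ^ 3 := by ring
  -- the planar form
  have hQ : slyQ d α β h₁ h₂ 0 =
      (((α : ℝ) + d - 2) / (α * (α - 1) ^ 2) - (β + d * α) / (α ^ 2 * β) + d / ((1 - α) * (1 - β)) -
          d / (β * (1 - β) * (1 - α - β))) * h₁ ^ 2 / 2 +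
        (-(1 - α - β + d * α * β) / (β ^ 2 * (1 - β) ^ 2 * (1 - α - β))) * h₂ ^ 2 / 2 +
        (d / (β * (1 - β) * (1 - α - β))) * h₁ * h₂ := by
    unfold slyQ; ring
  rw [hQ]
  have a1 := abs_nonneg h₁; have a2 := abs_nonneg h₂
  have sq1 : h₁ ^ 2 = |h₁| ^ 2 := (sq_abs h₁).symm
  have sq2 : h₂ ^ 2 = |h₂| ^ 2 := (sq_abs h₂).symm
  have x12 : |h₁ * h₂| = |h₁| * |h₂| := abs_mul h₁ h₂
  -- coefficient magnitude bounds
  set c11 := ((α : ℝ) + d - 2) / (α * (α - 1) ^ 2) - (β + d * α) / (α ^ 2 * β) +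
    d / ((1 - α) * (1 - β)) - d / (β * (1 - β) * (1 - α - β)) with hc11
  set c22 := -(1 - α - β + (d : ℝ) * α * β) / (β ^ 2 * (1 - β) ^ 2 * (1 - α - β)) with hc22
  set c12 := (d : ℝ) / (β * (1 - β) * (1 - α - β)) with hc12
  have hc11b : |c11| ≤ (4 * (d : ℝ) + 4) / m ^ 5 := by
    have T1 := abs_le.mp t1; have T2 := abs_le.mp t2; have T3 := abs_le.mp t3
    have T4 := abs_le.mp t4
    have h4 : |c11| ≤ ((d : ℝ) + 2) / m ^ 3 + ((d : ℝ) + 1) / m ^ 3 + d / m ^ 3 + d / m ^ 3 := by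
      rw [hc11, abs_le]
      constructor <;> linarith [T1.1, T1.2, T2.1, T2.2, T3.1, T3.2, T4.1, T4.2]
    calc |c11| ≤ ((d : ℝ) + 2) / m ^ 3 + ((d : ℝ) + 1) / m ^ 3 + d / m ^ 3 + d / m ^ 3 := h4
      _ = (4 * (d : ℝ) + 3) * (1 / m ^ 3) := by ring
      _ ≤ (4 * (d : ℝ) + 3) * (1 / m ^ 5) := mul_le_mul_of_nonneg_left hm35 (by positivity)
      _ ≤ (4 * (d : ℝ) + 4) / m ^ 5 := by
          rw [div_eq_mul_one_div (4 * (d:ℝ) + 4)]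
          apply mul_le_mul_of_nonneg_right (by linarith) (by positivity)
  have hc22b : |c22| ≤ ((d : ℝ) + 1) / m ^ 5 := t5
  have hc12b : |c12| ≤ (d : ℝ) / m ^ 5 := le_trans t4 (by
    rw [div_eq_mul_one_div, div_eq_mul_one_div (d : ℝ)]
    exact mul_le_mul_of_nonneg_left hm35 hd)
  -- conclude
  calc |c11 * h₁ ^ 2 / 2 + c22 * h₂ ^ 2 / 2 + c12 * h₁ * h₂|
      ≤ |c11 * h₁ ^ 2 / 2| + |c22 * h₂ ^ 2 / 2| + |c12 * h₁ * h₂| :=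
        le_trans (abs_add_le _ _) (add_le_add (abs_add_le _ _) le_rfl)
    _ = |c11| * |h₁| ^ 2 / 2 + |c22| * |h₂| ^ 2 / 2 + |c12| * (|h₁| * |h₂|) := by
        rw [abs_div, abs_mul, abs_of_pos (by norm_num : (0:ℝ) < 2), abs_pow, abs_div, abs_mul,
          abs_of_pos (by norm_num : (0:ℝ) < 2), abs_pow, mul_assoc c12, abs_mul, x12]
    _ ≤ (4 * (d : ℝ) + 4) / m ^ 5 * |h₁| ^ 2 / 2 + ((d : ℝ) + 1) / m ^ 5 * |h₂| ^ 2 / 2 +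
          (d : ℝ) / m ^ 5 * (|h₁| * |h₂|) := by
        gcongr
    _ ≤ 3 * ((d : ℝ) + 2) / m ^ 5 * (|h₁| + |h₂|) ^ 2 := by
        have hm5 : 0 < 1 / m ^ 5 := by positivity
        rw [div_eq_mul_one_div (4 * (d:ℝ) + 4), div_eq_mul_one_div ((d:ℝ) + 1),
          div_eq_mul_one_div (d:ℝ), div_eq_mul_one_div (3 * ((d:ℝ) + 2))]
        nlinarith [mul_nonneg a1 a2, sq_nonneg (|h₁| - |h₂|), hm5, hd,
          mul_nonneg hm5.le (mul_nonneg a1 a2), mul_nonneg hm5.le (sq_nonneg (|h₁|)),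
          mul_nonneg hm5.le (sq_nonneg (|h₂|)), mul_nonneg hd hm5.le]

end QuadBound

section FarGap

variable {α β : ℝ}

set_option maxHeartbeats 1600000 in
/-- **The far gap of the colour rate** (discharging the `hfar` hypothesis of `slyInner_sum_le`):
if `-H_d ≻ κ` (`hPD`) and `f_d ≤ -η` outside the `r₀`-ball (`hgap`), then for `c = c* + h` in the
polytope with `|h₁|+|h₂| ≤ c₀ w < w < |h₃|` (and the listed smallness conditions),
`d (G(c) - M_B(h₁,h₂)) ≤ -(κ/2) w²`. [cite: Sly2010, §3.2–3.3; MosselWeitzWormald2008, proof of Theorem 6.11] -/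
theorem slyFar_gap (d : ℕ) (hα : 0 < α) (hβ : 0 < β) (hαβ : α + β < 1) {m : ℝ}
    (hm : m = min (min α β) (1 - α - β)) {κ η r₀ w c₀ : ℝ} (hκ : 0 < κ) (hw : 0 < w)
    (hc₀1 : c₀ ≤ 1)
    (hPD : ∀ h₁ h₂ h₃ : ℝ, slyQ d α β h₁ h₂ h₃ ≤ -κ * (h₁ ^ 2 + h₂ ^ 2 + h₃ ^ 2))
    (hgap : ∀ c ∈ slyPolytope α β, r₀ ≤ dist c (slyCstar α β) →
      slyRate d α β c.1 c.2.1 c.2.2 ≤ -η)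
    (hr₀ : 3 * r₀ ≤ m ^ 2 / 2) (hr₀κ : 12 * (4 + 7 * (d : ℝ)) * (8 * r₀) ≤ κ / 4 * m ^ 4)
    (hcw : c₀ * w ≤ m ^ 2 / 2) (hQ : 3 * ((d : ℝ) + 2) / m ^ 5 * c₀ ^ 2 ≤ κ / 8)
    (hcube : 48 * c₀ ^ 3 * w ≤ κ / 8 * m ^ 4) (hηw : κ * w ^ 2 ≤ η)
    {γ δ ε : ℝ} (hc : ((γ, δ, ε) : ℝ × ℝ × ℝ) ∈ slyPolytope α β)
    (h12 : |γ - α ^ 2| + |δ - β ^ 2| ≤ c₀ * w) (h3 : w < |ε - α * (1 - α - β)|) :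
    (d : ℝ) * (slyGrate α β γ δ ε - slyMB α β (γ - α ^ 2) (δ - β ^ 2)) ≤ -(κ / 2) * w ^ 2 := by
  set h₁ := γ - α ^ 2 with hh₁
  set h₂ := δ - β ^ 2 with hh₂
  set h₃ := ε - α * (1 - α - β) with hh₃
  have hm0 : 0 < m := by rw [hm]; exact lt_min (lt_min hα hβ) (by linarith)
  have hd0 : (0 : ℝ) ≤ d := Nat.cast_nonneg d
  have eγ : γ = α ^ 2 + h₁ := by rw [hh₁]; ring
  have eδ : δ = β ^ 2 + h₂ := by rw [hh₂]; ring
  have eε : ε = α * (1 - α - β) + h₃ := by rw [hh₃]; ring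
  -- `d G = f_d - f_0`, `f_0` at `h₃ = 0`
  have hG : (d : ℝ) * slyGrate α β γ δ ε = slyRate d α β γ δ ε - slyRate 0 α β γ δ ε := by
    rw [slyRate_eq_zero_add α β γ δ ε d]; ring
  have hf0 : slyRate 0 α β γ δ ε = slyRate 0 α β (α ^ 2 + h₁) (β ^ 2 + h₂) (α * (1 - α - β)) := by
    rw [eγ, eδ]; exact slyRate_zero α β _ _ _ _
  -- Taylor for `f_0` on the plane
  have s12 : |h₁| + |h₂| + |(0:ℝ)| ≤ m ^ 2 / 2 := by rw [abs_zero, add_zero]; linarith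
  have T0 := abs_slyRate_sub_slyQ_le 0 hα hβ hαβ hm rfl s12
  rw [abs_zero, add_zero] at T0
  rw [abs_le] at T0
  push_cast at T0
  norm_num at T0
  -- `d M_B ≥ Q_d(h₁,h₂,0) - Q_0(h₁,h₂,0)`
  have hMB : slyQ d α β h₁ h₂ 0 - slyQ 0 α β h₁ h₂ 0 ≤ (d : ℝ) * slyMB α β h₁ h₂ := by
    have e := slyQ_eq_zero_add α β d h₁ h₂ 0
    have l := slyQB_le_slyMB hα hβ hαβ h₁ h₂ 0
    unfold slyQB at l
    nlinarith [mul_le_mul_of_nonneg_left l hd0]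
  -- planar size of `Q_d`
  have hQd := abs_slyQ_plane_le d hα hβ hαβ hm h₁ h₂
  rw [abs_le] at hQd
  have hs12 : |h₁| + |h₂| ≤ c₀ * w := h12
  have hs12w : (|h₁| + |h₂|) ^ 2 ≤ c₀ ^ 2 * w ^ 2 := by
    calc (|h₁| + |h₂|) ^ 2 ≤ (c₀ * w) ^ 2 := pow_le_pow_left₀ (by positivity) hs12 2
      _ = c₀ ^ 2 * w ^ 2 := by ring
  have hs12c : (|h₁| + |h₂|) ^ 3 ≤ c₀ ^ 3 * w ^ 3 := by
    calc (|h₁| + |h₂|) ^ 3 ≤ (c₀ * w) ^ 3 := pow_le_pow_left₀ (by positivity) hs12 3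
      _ = c₀ ^ 3 * w ^ 3 := by ring
  have hQplane : |slyQ d α β h₁ h₂ 0| ≤ κ / 8 * w ^ 2 := by
    calc |slyQ d α β h₁ h₂ 0| ≤ 3 * ((d : ℝ) + 2) / m ^ 5 * (|h₁| + |h₂|) ^ 2 :=
          abs_slyQ_plane_le d hα hβ hαβ hm h₁ h₂
      _ ≤ 3 * ((d : ℝ) + 2) / m ^ 5 * (c₀ ^ 2 * w ^ 2) :=
          mul_le_mul_of_nonneg_left hs12w (by positivity)
      _ = (3 * ((d : ℝ) + 2) / m ^ 5 * c₀ ^ 2) * w ^ 2 := by ring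
      _ ≤ κ / 8 * w ^ 2 := mul_le_mul_of_nonneg_right hQ (by positivity)
  have hcubic : 48 * ((|h₁| + |h₂|) ^ 3 / m ^ 4) ≤ κ / 8 * w ^ 2 := by
    have hm4 : 0 < m ^ 4 := by positivity
    rw [mul_div_assoc']
    rw [div_le_iff₀ hm4]
    calc 48 * (|h₁| + |h₂|) ^ 3 ≤ 48 * (c₀ ^ 3 * w ^ 3) := by nlinarith [hs12c]
      _ = (48 * c₀ ^ 3 * w) * w ^ 2 := by ring
      _ ≤ (κ / 8 * m ^ 4) * w ^ 2 := mul_le_mul_of_nonneg_right hcube (by positivity)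
      _ = κ / 8 * w ^ 2 * m ^ 4 := by ring
  rw [abs_le] at hQplane
  have hw3 : w ^ 2 < h₃ ^ 2 := by
    have := sq_lt_sq' (by linarith [abs_nonneg h₃]) h3
    rw [sq_abs] at this
    nlinarith [abs_nonneg h₃, sq_abs h₃, h3]
  -- the two cases
  by_cases hnear : dist ((γ, δ, ε) : ℝ × ℝ × ℝ) (slyCstar α β) < r₀
  · -- Taylor for `f_d`
    have hd1 : |h₁| < r₀ := by
      have := hnear; rw [slyCstar, Prod.dist_eq, Real.dist_eq] at this
      exact lt_of_le_of_lt (le_max_left _ _) this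
    have hd23 : |h₂| < r₀ ∧ |h₃| < r₀ := by
      have := hnear; rw [slyCstar, Prod.dist_eq, Prod.dist_eq, Real.dist_eq, Real.dist_eq] at this
      exact ⟨lt_of_le_of_lt (le_trans (le_max_left _ _) (le_max_right _ _)) this,
        lt_of_le_of_lt (le_trans (le_max_right _ _) (le_max_right _ _)) this⟩
    have hs : |h₁| + |h₂| + |h₃| ≤ m ^ 2 / 2 := by linarith [hd23.1, hd23.2]
    have Td := abs_slyRate_sub_slyQ_le d hα hβ hαβ hm rfl hs
    rw [abs_le] at Td
    rw [← eγ, ← eδ, ← eε] at Td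
    have hPDh := hPD h₁ h₂ h₃
    -- `s³ ≤ 8 r₀ h₃²`
    have hs3 : (|h₁| + |h₂| + |h₃|) ^ 3 / m ^ 4 ≤ 8 * r₀ * h₃ ^ 2 / m ^ 4 := by
      apply div_le_div_of_nonneg_right _ (by positivity)
      have hle : |h₁| + |h₂| + |h₃| ≤ 2 * |h₃| := by
        have : c₀ * w ≤ w := by nlinarith
        linarith
      calc (|h₁| + |h₂| + |h₃|) ^ 3 ≤ (2 * |h₃|) ^ 3 := pow_le_pow_left₀ (by positivity) hle 3
        _ = 8 * |h₃| * |h₃| ^ 2 := by ring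
        _ ≤ 8 * r₀ * |h₃| ^ 2 := by
            apply mul_le_mul_of_nonneg_right _ (by positivity)
            linarith [hd23.2]
        _ = 8 * r₀ * h₃ ^ 2 := by rw [sq_abs]
    have hrem : 12 * (4 + 7 * (d : ℝ)) * ((|h₁| + |h₂| + |h₃|) ^ 3 / m ^ 4) ≤ κ / 4 * h₃ ^ 2 := by
      have hm4 : 0 < m ^ 4 := by positivity
      calc 12 * (4 + 7 * (d : ℝ)) * ((|h₁| + |h₂| + |h₃|) ^ 3 / m ^ 4)
          ≤ 12 * (4 + 7 * (d : ℝ)) * (8 * r₀ * h₃ ^ 2 / m ^ 4) :=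
            mul_le_mul_of_nonneg_left hs3 (by positivity)
        _ = (12 * (4 + 7 * (d : ℝ)) * (8 * r₀)) * h₃ ^ 2 / m ^ 4 := by ring
        _ ≤ (κ / 4 * m ^ 4) * h₃ ^ 2 / m ^ 4 := by
            apply div_le_div_of_nonneg_right _ hm4.le
            exact mul_le_mul_of_nonneg_right hr₀κ (by positivity)
        _ = κ / 4 * h₃ ^ 2 := by field_simp
    have hPD3 : slyQ d α β h₁ h₂ h₃ + κ * h₃ ^ 2 ≤ 0 := by
      have e : -κ * (h₁ ^ 2 + h₂ ^ 2 + h₃ ^ 2) = -(κ * h₁ ^ 2) - κ * h₂ ^ 2 - κ * h₃ ^ 2 := by ring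
      have p1 : 0 ≤ κ * h₁ ^ 2 := by positivity
      have p2 : 0 ≤ κ * h₂ ^ 2 := by positivity
      rw [e] at hPDh; linarith
    have hκw : κ * w ^ 2 ≤ κ * h₃ ^ 2 := mul_le_mul_of_nonneg_left hw3.le hκ.le
    rw [mul_sub, hG, hf0]
    linarith [Td.2, hrem, hPD3, T0.1, hMB, hQplane.1, hcubic, hκw]
  · push Not at hnear
    have hfar := hgap _ hc hnear
    simp only at hfar
    have hκw0 : 0 ≤ κ * w ^ 2 := by positivity
    rw [mul_sub, hG, hf0]
    linarith [hfar, T0.1, hMB, hQplane.1, hcubic, hηw, hκw0]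

end FarGap

section PrefA

/-- The six varying cell densities of the overlap prefactor. [folklore] -/
def slyCellsA (α β γ δ : ℝ) : List ℝ := [γ, α - γ, 1 - α - (α - γ), δ, β - δ, 1 - β - (β - δ)]

/-- `|log u - log v| ≤ |u - v|/m₀` for `u, v ≥ m₀ > 0`. [folklore] -/
private theorem abs_log_sub_log_le_div' {u v m₀ : ℝ} (hm : 0 < m₀) (hu : m₀ ≤ u) (hv : m₀ ≤ v) :
    |Real.log u - Real.log v| ≤ |u - v| / m₀ := by
  have hu0 : 0 < u := lt_of_lt_of_le hm hu
  have hv0 : 0 < v := lt_of_lt_of_le hm hv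
  rw [abs_le]
  constructor
  · -- `log v - log u ≤ (v - u)/u ≤ |u - v|/m₀`
    have h1 : Real.log v - Real.log u ≤ (v - u) / u := by
      rw [← Real.log_div hv0.ne' hu0.ne']
      have := Real.log_le_sub_one_of_pos (div_pos hv0 hu0)
      rw [div_sub_one hu0.ne'] at this
      exact this
    have h2 : (v - u) / u ≤ |u - v| / m₀ := by
      rw [div_le_div_iff₀ hu0 hm]
      have := le_abs_self (v - u)
      rw [abs_sub_comm] at this
      nlinarith [abs_nonneg (u - v)]
    linarith
  · have h1 : Real.log u - Real.log v ≤ (u - v) / v := by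
      rw [← Real.log_div hu0.ne' hv0.ne']
      have := Real.log_le_sub_one_of_pos (div_pos hu0 hv0)
      rw [div_sub_one hv0.ne'] at this
      exact this
    have h2 : (u - v) / v ≤ |u - v| / m₀ := by
      rw [div_le_div_iff₀ hv0 hm]
      nlinarith [le_abs_self (u - v), abs_nonneg (u - v)]
    linarith

/-- **The overlap prefactor is Lipschitz away from the walls**:
`|Pref_A(c) - Pref_A(c')| ≤ 8 ((|γ-γ'| + |δ-δ'|)/m₀)`. [folklore] -/
theorem abs_slyPrefA_sub_le {α β γ δ γ' δ' m₀ : ℝ} (hm : 0 < m₀)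
    (hc : ∀ u ∈ slyCellsA α β γ δ, m₀ ≤ u) (hc' : ∀ u ∈ slyCellsA α β γ' δ', m₀ ≤ u) :
    |slyPrefA α β γ δ - slyPrefA α β γ' δ'| ≤ 8 * ((|γ - γ'| + |δ - δ'|) / m₀) := by
  set D := |γ - γ'| + |δ - δ'| with hD
  have L : ∀ {u v : ℝ}, m₀ ≤ u → m₀ ≤ v → |u - v| ≤ D → |Real.log u - Real.log v| ≤ D / m₀ := by
    intro u v hu hv huv
    exact le_trans (abs_log_sub_log_le_div' hm hu hv) (div_le_div_of_nonneg_right huv hm.le)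
  have m1 := hc γ (by simp [slyCellsA]); have m1' := hc' γ' (by simp [slyCellsA])
  have m2 := hc (α - γ) (by simp [slyCellsA]); have m2' := hc' (α - γ') (by simp [slyCellsA])
  have m3 := hc (1 - α - (α - γ)) (by simp [slyCellsA])
  have m3' := hc' (1 - α - (α - γ')) (by simp [slyCellsA])
  have m4 := hc δ (by simp [slyCellsA]); have m4' := hc' δ' (by simp [slyCellsA])
  have m5 := hc (β - δ) (by simp [slyCellsA]); have m5' := hc' (β - δ') (by simp [slyCellsA])
  have m6 := hc (1 - β - (β - δ)) (by simp [slyCellsA])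
  have m6' := hc' (1 - β - (β - δ')) (by simp [slyCellsA])
  have g1 := le_abs_self (γ - γ'); have g2 := neg_abs_le (γ - γ')
  have g3 := le_abs_self (δ - δ'); have g4 := neg_abs_le (δ - δ')
  have T1 := abs_le.mp (L m1 m1' (by rw [hD]; linarith [abs_nonneg (δ - δ')]))
  have T2 := abs_le.mp (L m2 m2' (by rw [abs_le]; constructor <;> linarith))
  have T3 := abs_le.mp (L m3 m3' (by rw [abs_le]; constructor <;> linarith))
  have T4 := abs_le.mp (L m4 m4' (by rw [hD]; linarith [abs_nonneg (γ - γ')]))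
  have T5 := abs_le.mp (L m5 m5' (by rw [abs_le]; constructor <;> linarith))
  have T6 := abs_le.mp (L m6 m6' (by rw [abs_le]; constructor <;> linarith))
  have hDm : 0 ≤ D / m₀ := by positivity
  unfold slyPrefA
  rw [abs_le]
  constructor
  · linarith [T1.1, T1.2, T2.1, T2.2, T3.1, T3.2, T4.1, T4.2, T5.1, T5.2, T6.1, T6.2]
  · linarith [T1.1, T1.2, T2.1, T2.2, T3.1, T3.2, T4.1, T4.2, T5.1, T5.2, T6.1, T6.2]

variable {α β : ℝ}

/-- At the product point the six overlap cells are at least `m²`. [folklore] -/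
theorem slyCellsA_cstar_ge (hα : 0 < α) (hβ : 0 < β) (hαβ : α + β < 1) {m : ℝ}
    (hm : m = min (min α β) (1 - α - β)) :
    ∀ u ∈ slyCellsA α β (α ^ 2) (β ^ 2), m ^ 2 ≤ u := by
  have h1 : m ≤ α := by rw [hm]; exact le_trans (min_le_left _ _) (min_le_left _ _)
  have h2 : m ≤ β := by rw [hm]; exact le_trans (min_le_left _ _) (min_le_right _ _)
  have h3 : m ≤ 1 - α - β := by rw [hm]; exact min_le_right _ _
  have hm0 : 0 < m := by rw [hm]; exact lt_min (lt_min hα hβ) (by linarith)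
  have hα1 : m ≤ 1 - α := by linarith
  have hβ1 : m ≤ 1 - β := by linarith
  intro u hu
  simp only [slyCellsA, List.mem_cons, List.mem_nil_iff, or_false] at hu
  have P : ∀ {x y : ℝ}, m ≤ x → m ≤ y → m ^ 2 ≤ x * y := fun hx hy => by
    rw [sq]; exact mul_le_mul hx hy hm0.le (le_trans hm0.le hx)
  rcases hu with rfl | rfl | rfl | rfl | rfl | rfl
  · calc m ^ 2 ≤ α * α := P h1 h1
      _ = α ^ 2 := by ring
  · nlinarith [P h1 hα1]
  · nlinarith [P hα1 hα1]
  · calc m ^ 2 ≤ β * β := P h2 h2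
      _ = β ^ 2 := by ring
  · nlinarith [P h2 hβ1]
  · nlinarith [P hβ1 hβ1]

/-- Near the product point the six overlap cells are at least `m²/2`. [folklore] -/
theorem slyCellsA_near_ge (hα : 0 < α) (hβ : 0 < β) (hαβ : α + β < 1) {m : ℝ}
    (hm : m = min (min α β) (1 - α - β)) {γ δ : ℝ}
    (hnear : |γ - α ^ 2| + |δ - β ^ 2| ≤ m ^ 2 / 2) :
    ∀ u ∈ slyCellsA α β γ δ, m ^ 2 / 2 ≤ u := by
  have H := slyCellsA_cstar_ge hα hβ hαβ hm
  have g1 := le_abs_self (γ - α ^ 2); have g2 := neg_abs_le (γ - α ^ 2)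
  have g3 := le_abs_self (δ - β ^ 2); have g4 := neg_abs_le (δ - β ^ 2)
  have c1 := H (α ^ 2) (by simp [slyCellsA])
  have c2 := H (α - α ^ 2) (by simp [slyCellsA])
  have c3 := H (1 - α - (α - α ^ 2)) (by simp [slyCellsA])
  have c4 := H (β ^ 2) (by simp [slyCellsA])
  have c5 := H (β - β ^ 2) (by simp [slyCellsA])
  have c6 := H (1 - β - (β - β ^ 2)) (by simp [slyCellsA])
  intro u hu
  simp only [slyCellsA, List.mem_cons, List.mem_nil_iff, or_false] at hu
  rcases hu with rfl | rfl | rfl | rfl | rfl | rfl <;> linarith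

/-- **Overlap cells give the integer interior conditions** of `log_slyAcoef_interior`. [folklore] -/
theorem slyInteriorA_of_cells {n a b g h μ : ℕ} {m₀ : ℝ} (hn : 0 < n)
    (hμ : (μ : ℝ) ≤ n * m₀)
    (hc : ∀ u ∈ slyCellsA ((a : ℝ) / n) ((b : ℝ) / n) ((g : ℝ) / n) ((h : ℝ) / n), m₀ ≤ u) :
    (μ ≤ g ∧ g + μ ≤ a ∧ a - g + μ ≤ n - a) ∧ (μ ≤ h ∧ h + μ ≤ b ∧ b - h + μ ≤ n - b) := by
  have hnR : (0 : ℝ) < n := by exact_mod_cast hn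
  have S : ∀ {u : ℝ}, m₀ ≤ u → (n : ℝ) * m₀ ≤ n * u := fun hu => mul_le_mul_of_nonneg_left hu hnR.le
  have m1 := S (hc ((g : ℝ) / n) (by simp [slyCellsA]))
  have m2 := S (hc ((a : ℝ) / n - (g : ℝ) / n) (by simp [slyCellsA]))
  have m3 := S (hc (1 - (a : ℝ) / n - ((a : ℝ) / n - (g : ℝ) / n)) (by simp [slyCellsA]))
  have m4 := S (hc ((h : ℝ) / n) (by simp [slyCellsA]))
  have m5 := S (hc ((b : ℝ) / n - (h : ℝ) / n) (by simp [slyCellsA]))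
  have m6 := S (hc (1 - (b : ℝ) / n - ((b : ℝ) / n - (h : ℝ) / n)) (by simp [slyCellsA]))
  rw [show (n : ℝ) * ((g : ℝ) / n) = g by field_simp] at m1
  rw [show (n : ℝ) * ((a : ℝ) / n - (g : ℝ) / n) = a - g by field_simp] at m2
  rw [show (n : ℝ) * (1 - (a : ℝ) / n - ((a : ℝ) / n - (g : ℝ) / n)) = n - a - (a - g) by
    field_simp] at m3
  rw [show (n : ℝ) * ((h : ℝ) / n) = h by field_simp] at m4
  rw [show (n : ℝ) * ((b : ℝ) / n - (h : ℝ) / n) = b - h by field_simp] at m5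
  rw [show (n : ℝ) * (1 - (b : ℝ) / n - ((b : ℝ) / n - (h : ℝ) / n)) = n - b - (b - h) by
    field_simp] at m6
  have i1 : μ ≤ g := by exact_mod_cast le_trans hμ m1
  have i2 : μ + g ≤ a := by
    have : ((μ + g : ℕ) : ℝ) ≤ ((a : ℕ) : ℝ) := by push_cast; linarith
    exact_mod_cast this
  have i3 : μ + a + a ≤ n + g := by
    have : ((μ + a + a : ℕ) : ℝ) ≤ ((n + g : ℕ) : ℝ) := by push_cast; linarith
    exact_mod_cast this
  have i4 : μ ≤ h := by exact_mod_cast le_trans hμ m4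
  have i5 : μ + h ≤ b := by
    have : ((μ + h : ℕ) : ℝ) ≤ ((b : ℕ) : ℝ) := by push_cast; linarith
    exact_mod_cast this
  have i6 : μ + b + b ≤ n + h := by
    have : ((μ + b + b : ℕ) : ℝ) ≤ ((n + h : ℕ) : ℝ) := by push_cast; linarith
    exact_mod_cast this
  omega

end PrefA

end Literature.Computability.Complexity
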